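import Mathlib

/-!
# Analytic continuation of `log Z` from bounds on its Taylor coefficients

Topic `Analysis/Complex`. Let `Z : ℂ → ℂ` be entire with `Z 0` off the closed negative real axis, and
let `aₙ = (log Z)⁽ⁿ⁾(0)/n!` be the Taylor coefficients at `0` of the (locally defined, principal)
logarithm `F = log ∘ Z`. If the coefficients obey a GEOMETRIC bound `‖aₙ‖ ≤ A·Bⁿ⁻²` for `n ≥ 2`,
then on every disc `‖z‖ < r` with `B r < 1`:

* `eqOn_cexp_tsum_of_taylor_bound` — `Z z = exp (Σₙ aₙ zⁿ)` (the Taylor series of `log Z` continues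
  `log Z` analytically to the disc and exponentiates to `Z`: Taylor's theorem on a small disc where
  `log ∘ Z` is holomorphic, then the identity theorem for `exp ∘ T` and `Z` on the big disc);
* `ne_zero_of_taylor_bound` — in particular **`Z` has no zeros in the disc `‖z‖ < 1/B`**;
* `abs_log_norm_sub_sub_re_le_of_taylor_bound` —
  `|log ‖Z z‖ - log ‖Z 0‖ - Re(a₁ z)| ≤ A‖z‖²/(1 - B‖z‖)`, and `≤ 2A‖z‖²` once `B‖z‖ ≤ 1/2`
  (`abs_log_norm_sub_sub_re_le_two_mul`); with `Z'(0) = 0` (an even `Z`, say) the linear term is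
  absent (`abs_log_norm_sub_le_two_mul_of_deriv_eq_zero`).

This is the elementary complex analysis behind reading a bound on a "pressure gain"
`log Z(s) - log Z(0)`, `s` real and small, off bounds on the CUMULANTS (Taylor coefficients of
`log Z` at zero source) — the form in which a perturbative/multiscale analysis at zero source delivers
its output — without any a-priori control of `Z` at nonzero (complex) source: the cumulant bound
itself continues `log Z` and excludes zeros (`ne_zero_of_taylor_bound`). Everything is PROVED; no
definition is introduced (the coefficients are written `(n!)⁻¹ · iteratedDeriv n (log ∘ Z) 0`).

## References

* E. C. Titchmarsh, *The Theory of Functions*, 2nd ed. (1939), §2.4, §4.1 (Taylor series on the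
  disc of holomorphy; analytic continuation by power series). [Titchmarsh1939]
* D. Ruelle, *Statistical Mechanics: Rigorous Results* (1969), §4.4 (pressure, zeros of the partition
  function and analyticity of `log Z`). [Ruelle1969]
-/

noncomputable section

open Complex Filter Topology Set Metric
open scoped Nat

namespace Literature.Analysis.Complex

variable {Z : ℂ → ℂ} {A B : ℝ}

/-! ### The Taylor series of `log ∘ Z` with geometrically bounded coefficients -/

/-- Geometric tail bound for the coefficients: with `aₙ = (n!)⁻¹ F⁽ⁿ⁾(0)` and `‖aₙ‖ ≤ A Bⁿ⁻²`
(`n ≥ 2`), for every `n` one has `‖aₙ‖ rⁿ ≤ (‖a₀‖ + ‖a₁‖ r + A r²) (B r)ⁿ⁻²` whenever `0 ≤ r`.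
[folklore] -/
theorem norm_taylorCoeff_mul_pow_le (F : ℂ → ℂ) (hA : 0 ≤ A) (hB : 0 ≤ B)
    (hK : ∀ n : ℕ, 2 ≤ n → ‖((n ! : ℂ))⁻¹ * iteratedDeriv n F 0‖ ≤ A * B ^ (n - 2))
    {r : ℝ} (hr : 0 ≤ r) (n : ℕ) :
    ‖((n ! : ℂ))⁻¹ * iteratedDeriv n F 0‖ * r ^ n ≤
      (‖((0 ! : ℂ))⁻¹ * iteratedDeriv 0 F 0‖ + ‖((1 ! : ℂ))⁻¹ * iteratedDeriv 1 F 0‖ * r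
        + A * r ^ 2) * (B * r) ^ (n - 2) := by
  have h0 : 0 ≤ ‖((0 ! : ℂ))⁻¹ * iteratedDeriv 0 F 0‖ := norm_nonneg _
  have h1 : 0 ≤ ‖((1 ! : ℂ))⁻¹ * iteratedDeriv 1 F 0‖ * r := mul_nonneg (norm_nonneg _) hr
  have h2 : 0 ≤ A * r ^ 2 := by positivity
  have hBr0 : 0 ≤ B * r := mul_nonneg hB hr
  rcases Nat.lt_or_ge n 2 with hn | hn
  · interval_cases n
    · simp only [pow_zero, mul_one, Nat.zero_sub]
      linarith
    · simp only [pow_one, Nat.reduceSub, pow_zero, mul_one]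
      linarith
  · obtain ⟨m, rfl⟩ := Nat.exists_eq_add_of_le' hn
    simp only [Nat.add_sub_cancel]
    have key : ‖((((m + 2) ! : ℕ) : ℂ))⁻¹ * iteratedDeriv (m + 2) F 0‖ * r ^ (m + 2) ≤
        A * r ^ 2 * (B * r) ^ m := by
      have := hK (m + 2) (by omega)
      simp only [Nat.add_sub_cancel] at this
      calc ‖((((m + 2) ! : ℕ) : ℂ))⁻¹ * iteratedDeriv (m + 2) F 0‖ * r ^ (m + 2)
          ≤ A * B ^ m * r ^ (m + 2) := mul_le_mul_of_nonneg_right this (pow_nonneg hr _)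
        _ = A * r ^ 2 * (B * r) ^ m := by ring
    calc _ ≤ A * r ^ 2 * (B * r) ^ m := key
      _ ≤ _ := by
        have : 0 ≤ (B * r) ^ m := pow_nonneg hBr0 _
        nlinarith

/-- The Taylor series `T z = Σₙ aₙ zⁿ` of `F` at `0`, with `‖aₙ‖ ≤ A Bⁿ⁻²` (`n ≥ 2`), has summable
terms on the closed disc `‖z‖ ≤ r`, `B r < 1`: `Σₙ ‖aₙ‖ rⁿ < ∞`. [folklore] -/
theorem summable_norm_taylorCoeff_mul_pow (F : ℂ → ℂ) (hA : 0 ≤ A) (hB : 0 ≤ B)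
    (hK : ∀ n : ℕ, 2 ≤ n → ‖((n ! : ℂ))⁻¹ * iteratedDeriv n F 0‖ ≤ A * B ^ (n - 2))
    {r : ℝ} (hr : 0 ≤ r) (hBr : B * r < 1) :
    Summable fun n : ℕ => ‖((n ! : ℂ))⁻¹ * iteratedDeriv n F 0‖ * r ^ n := by
  have hBr0 : 0 ≤ B * r := mul_nonneg hB hr
  have hgeo : Summable fun n : ℕ => (B * r) ^ (n - 2) := by
    rw [← summable_nat_add_iff 2]
    simpa only [Nat.add_sub_cancel] using summable_geometric_of_lt_one hBr0 hBr
  refine Summable.of_nonneg_of_le (fun n => by positivity)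
    (fun n => norm_taylorCoeff_mul_pow_le F hA hB hK hr n) (hgeo.mul_left _)

/-- The Taylor series `T z = Σₙ (n!)⁻¹ F⁽ⁿ⁾(0) zⁿ` with `‖(n!)⁻¹F⁽ⁿ⁾(0)‖ ≤ A Bⁿ⁻²` (`n ≥ 2`) is
holomorphic on the disc `‖z‖ < r` whenever `B r < 1`. [folklore] -/
theorem differentiableOn_tsum_taylorCoeff (F : ℂ → ℂ) (hA : 0 ≤ A) (hB : 0 ≤ B)
    (hK : ∀ n : ℕ, 2 ≤ n → ‖((n ! : ℂ))⁻¹ * iteratedDeriv n F 0‖ ≤ A * B ^ (n - 2))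
    {r : ℝ} (hr : 0 ≤ r) (hBr : B * r < 1) :
    DifferentiableOn ℂ (fun z : ℂ => ∑' n : ℕ, ((n ! : ℂ))⁻¹ * iteratedDeriv n F 0 * z ^ n)
      (ball (0 : ℂ) r) := by
  refine differentiableOn_tsum_of_summable_norm
    (summable_norm_taylorCoeff_mul_pow F hA hB hK hr hBr)
    (fun n => ((differentiable_const _).mul (differentiable_pow n)).differentiableOn)
    isOpen_ball (fun n w hw => ?_)
  rw [norm_mul, norm_pow]
  have hw' : ‖w‖ ≤ r := by
    rw [mem_ball_zero_iff] at hw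
    exact hw.le
  exact mul_le_mul_of_nonneg_left (pow_le_pow_left₀ (norm_nonneg _) hw' n) (norm_nonneg _)

/-! ### Taylor's theorem for `log ∘ Z` near `0` -/

/-- Near a point where `Z 0` lies in the slit plane, the principal logarithm `log ∘ Z` of a
holomorphic `Z` is holomorphic, is the sum of its Taylor series, and exponentiates to `Z`.
[cite: Titchmarsh1939, §2.4] -/
theorem exists_ball_tsum_taylorCoeff_clog_eq (hZ : Differentiable ℂ Z) (h0 : Z 0 ∈ slitPlane) :
    ∃ ρ : ℝ, 0 < ρ ∧ ∀ z ∈ ball (0 : ℂ) ρ,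
      (∑' n : ℕ, ((n ! : ℂ))⁻¹ * iteratedDeriv n (fun w => log (Z w)) 0 * z ^ n) = log (Z z) ∧
      exp (log (Z z)) = Z z := by
  -- an open ball around `0` on which `Z` stays in the slit plane
  have hpre : Z ⁻¹' slitPlane ∈ 𝓝 (0 : ℂ) :=
    hZ.continuous.continuousAt.preimage_mem_nhds (isOpen_slitPlane.mem_nhds h0)
  obtain ⟨ρ, hρ, hball⟩ := Metric.mem_nhds_iff.mp hpre
  refine ⟨ρ, hρ, fun z hz => ⟨?_, exp_log (slitPlane_ne_zero (hball hz))⟩⟩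
  have hF : DifferentiableOn ℂ (fun w => log (Z w)) (ball (0 : ℂ) ρ) :=
    hZ.differentiableOn.clog fun w hw => hball hw
  have := Complex.taylorSeries_eq_on_ball' hz hF
  simpa only [sub_zero] using this

/-! ### The continuation theorem -/

/-- **Analytic continuation of `log Z` by its Taylor series.** Let `Z` be entire with `Z 0` in the
slit plane, and suppose the Taylor coefficients `aₙ = (n!)⁻¹ (log ∘ Z)⁽ⁿ⁾(0)` satisfy
`‖aₙ‖ ≤ A Bⁿ⁻²` for `n ≥ 2`. Then on every disc `‖z‖ < r` with `B r < 1`,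
`exp (Σₙ aₙ zⁿ) = Z z`. [cite: Titchmarsh1939, §4.1] -/
theorem eqOn_cexp_tsum_of_taylor_bound (hZ : Differentiable ℂ Z) (h0 : Z 0 ∈ slitPlane)
    (hA : 0 ≤ A) (hB : 0 ≤ B)
    (hK : ∀ n : ℕ, 2 ≤ n →
      ‖((n ! : ℂ))⁻¹ * iteratedDeriv n (fun w => log (Z w)) 0‖ ≤ A * B ^ (n - 2))
    {r : ℝ} (hr : 0 < r) (hBr : B * r < 1) :
    EqOn (fun z : ℂ => exp (∑' n : ℕ, ((n ! : ℂ))⁻¹ * iteratedDeriv n (fun w => log (Z w)) 0 * z ^ n))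
      Z (ball (0 : ℂ) r) := by
  set F : ℂ → ℂ := fun w => log (Z w) with hFdef
  set T : ℂ → ℂ := fun z => ∑' n : ℕ, ((n ! : ℂ))⁻¹ * iteratedDeriv n F 0 * z ^ n with hTdef
  have hT : DifferentiableOn ℂ T (ball (0 : ℂ) r) :=
    differentiableOn_tsum_taylorCoeff F hA hB hK hr.le hBr
  have hET : AnalyticOnNhd ℂ (fun z => exp (T z)) (ball (0 : ℂ) r) :=
    (hT.cexp).analyticOnNhd isOpen_ball
  have hZa : AnalyticOnNhd ℂ Z (ball (0 : ℂ) r) := hZ.differentiableOn.analyticOnNhd isOpen_ball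
  obtain ⟨ρ, hρ, hloc⟩ := exists_ball_tsum_taylorCoeff_clog_eq hZ h0
  have hev : (fun z => exp (T z)) =ᶠ[𝓝 (0 : ℂ)] Z := by
    filter_upwards [Metric.ball_mem_nhds (0 : ℂ) hρ] with z hz
    obtain ⟨h1, h2⟩ := hloc z hz
    show exp (T z) = Z z
    rw [hTdef]
    dsimp only
    rw [h1, h2]
  exact hET.eqOn_of_preconnected_of_eventuallyEq hZa (convex_ball (0 : ℂ) r).isPreconnected
    (mem_ball_self hr) hev

/-- **No zeros in the disc.** Under the Taylor bound `‖aₙ‖ ≤ A Bⁿ⁻²` (`n ≥ 2`) on the coefficients of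
`log ∘ Z` at `0`, the entire function `Z` does not vanish on `‖z‖ < r` whenever `B r < 1` — i.e. on
the open disc of radius `1/B`. [cite: Ruelle1969, §4.4] -/
theorem ne_zero_of_taylor_bound (hZ : Differentiable ℂ Z) (h0 : Z 0 ∈ slitPlane)
    (hA : 0 ≤ A) (hB : 0 ≤ B)
    (hK : ∀ n : ℕ, 2 ≤ n →
      ‖((n ! : ℂ))⁻¹ * iteratedDeriv n (fun w => log (Z w)) 0‖ ≤ A * B ^ (n - 2))
    {r : ℝ} (hr : 0 < r) (hBr : B * r < 1) {z : ℂ} (hz : ‖z‖ < r) : Z z ≠ 0 := by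
  have := eqOn_cexp_tsum_of_taylor_bound hZ h0 hA hB hK hr hBr (mem_ball_zero_iff.mpr hz)
  rw [← this]
  exact exp_ne_zero _

/-! ### The bound on `log ‖Z‖` -/

/-- The tail of the Taylor series beyond the linear term is `O(‖z‖²)`:
`‖Σₙ≥₂ aₙ zⁿ‖ ≤ A‖z‖²/(1 - B‖z‖)` for `B‖z‖ < 1`. [folklore] -/
theorem norm_tsum_taylorCoeff_add_two_le (F : ℂ → ℂ) (hB : 0 ≤ B)
    (hK : ∀ n : ℕ, 2 ≤ n → ‖((n ! : ℂ))⁻¹ * iteratedDeriv n F 0‖ ≤ A * B ^ (n - 2))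
    {z : ℂ} (hz : B * ‖z‖ < 1) :
    ‖∑' n : ℕ, (((n + 2) ! : ℂ))⁻¹ * iteratedDeriv (n + 2) F 0 * z ^ (n + 2)‖ ≤
      A * ‖z‖ ^ 2 / (1 - B * ‖z‖) := by
  have hq0 : 0 ≤ B * ‖z‖ := mul_nonneg hB (norm_nonneg _)
  have hgeo : HasSum (fun n : ℕ => A * ‖z‖ ^ 2 * (B * ‖z‖) ^ n) (A * ‖z‖ ^ 2 / (1 - B * ‖z‖)) := by
    rw [div_eq_mul_inv]
    exact (hasSum_geometric_of_lt_one hq0 hz).mul_left _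
  have hle : ∀ n : ℕ, ‖(((n + 2) ! : ℂ))⁻¹ * iteratedDeriv (n + 2) F 0 * z ^ (n + 2)‖ ≤
      A * ‖z‖ ^ 2 * (B * ‖z‖) ^ n := fun n => by
    have := hK (n + 2) (by omega)
    simp only [Nat.add_sub_cancel] at this
    rw [norm_mul, norm_pow]
    calc ‖(((n + 2) ! : ℂ))⁻¹ * iteratedDeriv (n + 2) F 0‖ * ‖z‖ ^ (n + 2)
        ≤ A * B ^ n * ‖z‖ ^ (n + 2) := by
          have h := mul_le_mul_of_nonneg_right this (pow_nonneg (norm_nonneg z) (n + 2))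
          exact_mod_cast h
      _ = A * ‖z‖ ^ 2 * (B * ‖z‖) ^ n := by ring
  have hsum : Summable fun n : ℕ => ‖(((n + 2) ! : ℂ))⁻¹ * iteratedDeriv (n + 2) F 0 * z ^ (n + 2)‖ :=
    Summable.of_nonneg_of_le (fun n => norm_nonneg _) hle hgeo.summable
  calc _ ≤ ∑' n : ℕ, ‖(((n + 2) ! : ℂ))⁻¹ * iteratedDeriv (n + 2) F 0 * z ^ (n + 2)‖ :=
        norm_tsum_le_tsum_norm hsum
    _ ≤ ∑' n : ℕ, A * ‖z‖ ^ 2 * (B * ‖z‖) ^ n := hsum.tsum_le_tsum hle hgeo.summable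
    _ = A * ‖z‖ ^ 2 / (1 - B * ‖z‖) := hgeo.tsum_eq

/-- Splitting off the constant and linear Taylor terms: for `B‖z‖ < 1`,
`Σₙ aₙ zⁿ = log (Z 0) + (log ∘ Z)'(0) · z + Σₙ≥₂ aₙ zⁿ`. [folklore] -/
theorem tsum_taylorCoeff_eq_add (F : ℂ → ℂ) (hA : 0 ≤ A) (hB : 0 ≤ B)
    (hK : ∀ n : ℕ, 2 ≤ n → ‖((n ! : ℂ))⁻¹ * iteratedDeriv n F 0‖ ≤ A * B ^ (n - 2))
    {z : ℂ} (hz : B * ‖z‖ < 1) :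
    (∑' n : ℕ, ((n ! : ℂ))⁻¹ * iteratedDeriv n F 0 * z ^ n) =
      F 0 + deriv F 0 * z +
        ∑' n : ℕ, (((n + 2) ! : ℂ))⁻¹ * iteratedDeriv (n + 2) F 0 * z ^ (n + 2) := by
  have hs : Summable fun n : ℕ => ((n ! : ℂ))⁻¹ * iteratedDeriv n F 0 * z ^ n := by
    refine Summable.of_norm ?_
    have := summable_norm_taylorCoeff_mul_pow F hA hB hK (norm_nonneg z) hz
    refine this.congr fun n => ?_
    rw [norm_mul _ (z ^ n), norm_pow]
  rw [← hs.sum_add_tsum_nat_add 2]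
  simp only [Finset.sum_range_succ, Finset.sum_range_zero, zero_add, Nat.factorial_zero,
    Nat.cast_one, inv_one, iteratedDeriv_zero, pow_zero, mul_one, one_mul, Nat.factorial_one,
    iteratedDeriv_one, pow_one]

/-- **The cumulant bound controls `log ‖Z‖` on the disc.** Let `Z` be entire, `Z 0` in the slit
plane, with Taylor coefficients of `log ∘ Z` at `0` bounded by `‖aₙ‖ ≤ A Bⁿ⁻²` for `n ≥ 2`. Then for
`B‖z‖ < 1`:
`|log ‖Z z‖ - log ‖Z 0‖ - Re((log ∘ Z)'(0) · z)| ≤ A‖z‖²/(1 - B‖z‖)`. [cite: Ruelle1969, §4.4] -/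
theorem abs_log_norm_sub_sub_re_le_of_taylor_bound (hZ : Differentiable ℂ Z) (h0 : Z 0 ∈ slitPlane)
    (hA : 0 ≤ A) (hB : 0 ≤ B)
    (hK : ∀ n : ℕ, 2 ≤ n →
      ‖((n ! : ℂ))⁻¹ * iteratedDeriv n (fun w => log (Z w)) 0‖ ≤ A * B ^ (n - 2))
    {z : ℂ} (hz : B * ‖z‖ < 1) :
    |Real.log ‖Z z‖ - Real.log ‖Z 0‖ - (deriv (fun w => log (Z w)) 0 * z).re| ≤
      A * ‖z‖ ^ 2 / (1 - B * ‖z‖) := by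
  set F : ℂ → ℂ := fun w => log (Z w) with hFdef
  -- a radius `r` with `‖z‖ < r` and `B r < 1`
  obtain ⟨r, hzr, hBr⟩ : ∃ r : ℝ, ‖z‖ < r ∧ B * r < 1 := by
    rcases eq_or_lt_of_le hB with hB0 | hBpos
    · exact ⟨‖z‖ + 1, by linarith, by rw [← hB0]; simp⟩
    · have hzB : ‖z‖ < B⁻¹ := by
        refine lt_of_mul_lt_mul_left ?_ hBpos.le
        rwa [mul_inv_cancel₀ hBpos.ne']
      refine ⟨(‖z‖ + B⁻¹) / 2, by linarith, ?_⟩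
      have h1 : B * ((‖z‖ + B⁻¹) / 2) = (B * ‖z‖ + B * B⁻¹) / 2 := by ring
      rw [h1, mul_inv_cancel₀ hBpos.ne']
      linarith
  have hr : 0 < r := lt_of_le_of_lt (norm_nonneg z) hzr
  have hexp := eqOn_cexp_tsum_of_taylor_bound hZ h0 hA hB hK hr hBr (mem_ball_zero_iff.mpr hzr)
  simp only at hexp
  -- `log ‖Z z‖ = Re T z`
  have hlogz : Real.log ‖Z z‖ =
      (∑' n : ℕ, ((n ! : ℂ))⁻¹ * iteratedDeriv n F 0 * z ^ n).re := by
    rw [← hexp, norm_exp, Real.log_exp]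
  have hlog0 : Real.log ‖Z 0‖ = (F 0).re := by
    simp only [hFdef, log_re]
  rw [hlogz, hlog0, tsum_taylorCoeff_eq_add F hA hB hK hz]
  simp only [add_re]
  rw [show ∀ a b c : ℝ, a + b + c - a - b = c from fun a b c => by ring]
  calc |(∑' n : ℕ, (((n + 2) ! : ℂ))⁻¹ * iteratedDeriv (n + 2) F 0 * z ^ (n + 2)).re|
      ≤ ‖∑' n : ℕ, (((n + 2) ! : ℂ))⁻¹ * iteratedDeriv (n + 2) F 0 * z ^ (n + 2)‖ :=
        abs_re_le_norm _
    _ ≤ A * ‖z‖ ^ 2 / (1 - B * ‖z‖) := norm_tsum_taylorCoeff_add_two_le F hB hK hz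

/-- **Half-radius form.** For `B‖z‖ ≤ 1/2`:
`|log ‖Z z‖ - log ‖Z 0‖ - Re((log ∘ Z)'(0) · z)| ≤ 2A‖z‖²`. [cite: Ruelle1969, §4.4] -/
theorem abs_log_norm_sub_sub_re_le_two_mul (hZ : Differentiable ℂ Z) (h0 : Z 0 ∈ slitPlane)
    (hA : 0 ≤ A) (hB : 0 ≤ B)
    (hK : ∀ n : ℕ, 2 ≤ n →
      ‖((n ! : ℂ))⁻¹ * iteratedDeriv n (fun w => log (Z w)) 0‖ ≤ A * B ^ (n - 2))
    {z : ℂ} (hz : B * ‖z‖ ≤ 1 / 2) :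
    |Real.log ‖Z z‖ - Real.log ‖Z 0‖ - (deriv (fun w => log (Z w)) 0 * z).re| ≤
      2 * A * ‖z‖ ^ 2 := by
  have hz1 : B * ‖z‖ < 1 := by linarith
  refine (abs_log_norm_sub_sub_re_le_of_taylor_bound hZ h0 hA hB hK hz1).trans ?_
  rw [div_le_iff₀ (by linarith)]
  have : 0 ≤ A * ‖z‖ ^ 2 := by positivity
  nlinarith

/-- The linear Taylor coefficient of `log ∘ Z` at `0` is the logarithmic derivative `Z'(0)/Z(0)`;
in particular it vanishes when `Z'(0) = 0` (e.g. for an even `Z`). [folklore] -/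
theorem deriv_clog_comp_eq_zero (hZ : Differentiable ℂ Z) (h0 : Z 0 ∈ slitPlane)
    (h1 : deriv Z 0 = 0) : deriv (fun w => log (Z w)) 0 = 0 := by
  have := ((hZ 0).hasDerivAt.clog h0).deriv
  rw [this, h1, zero_div]

/-- **Even case / vanishing first derivative.** If moreover `Z'(0) = 0` then for `B‖z‖ ≤ 1/2`:
`|log ‖Z z‖ - log ‖Z 0‖| ≤ 2A‖z‖²`. [cite: Ruelle1969, §4.4] -/
theorem abs_log_norm_sub_le_two_mul_of_deriv_eq_zero (hZ : Differentiable ℂ Z)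
    (h0 : Z 0 ∈ slitPlane) (h1 : deriv Z 0 = 0) (hA : 0 ≤ A) (hB : 0 ≤ B)
    (hK : ∀ n : ℕ, 2 ≤ n →
      ‖((n ! : ℂ))⁻¹ * iteratedDeriv n (fun w => log (Z w)) 0‖ ≤ A * B ^ (n - 2))
    {z : ℂ} (hz : B * ‖z‖ ≤ 1 / 2) :
    |Real.log ‖Z z‖ - Real.log ‖Z 0‖| ≤ 2 * A * ‖z‖ ^ 2 := by
  have := abs_log_norm_sub_sub_re_le_two_mul hZ h0 hA hB hK hz
  rwa [deriv_clog_comp_eq_zero hZ h0 h1, zero_mul, zero_re, sub_zero] at this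

end Literature.Analysis.Complex
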